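import Summits.AtomisticToContinuum.Crystallization.Theses.PricedLinkCensus
import Summits.AtomisticToContinuum.Crystallization.Theorems.PricedLinkCensusLayeringGlue
import Summits.AtomisticToContinuum.Crystallization.Theorems.ChargedEnergyGap.Negative.Unconditional

/-!
# Route PricedLinkCensus — `ChargeFreeWindows` (item `stmt-AtomisticToContinuum-14236`) implies
the target `ZeroChargeBulk`

The support item `ChargeFreeWindows` reads: for every `R > 0` and every sequence of Lennard-Jones
ground states `x N` in `ℝ³`, the fraction of sites `i` whose window
`{j : dist (x N i) (x N j) ≤ R · nn_i}` contains a site that is not charge-free at tolerance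
`1/100` tends to `0`.  It is filed UNCONDITIONALLY.  This file records the converse of the glue
item `LayeringGlue : ZeroChargeBulk → ChargeFreeWindows` (proved in the tree,
`PricedLinkCensusLayeringGlue.lean`, `layeringGlue_proof`):

* `zeroChargeBulk_of_chargeFreeWindows : ChargeFreeWindows → ZeroChargeBulk` — a site that is not
  charge-free lies in its own window (`j = i`, distance `0 ≤ R · nn_i`), so with `R = 1` the
  charged fraction is at most the bad-window fraction (squeeze).

Together with `layeringGlue_proof` this makes the item, as filed, EQUIVALENT to the route's rank-0
target `ZeroChargeBulk` (zero link charge almost everywhere in Lennard-Jones ground states): it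
closes by `layeringGlue_proof ZeroChargeBulk_holds` the moment the target lands, an unconditional
proof of it IS the target (crystallisation-strength, open), and a refutation of the target
refutes it.
-/

namespace Summit.AtomisticToContinuum.Crystallization.Theorems

open Summit.AtomisticToContinuum.Crystallization.Theses.PricedLinkCensus
open Literature.MathematicalPhysics.StatisticalMechanics Literature.Geometry.DiscreteGeometry
open Filter Topology

/-- **`ChargeFreeWindows` implies the target** (`ChargeFreeWindows → ZeroChargeBulk`): along a
sequence of Lennard-Jones ground states, a site `i` that is not charge-free at tolerance `1/100`
violates the window condition at radius `R = 1` with `j = i`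
(`dist (x N i) (x N i) = 0 ≤ 1 · nn_i`), so `#{charged sites} ≤ #{sites with a charged site in
their window}` and the charged fraction is squeezed to `0`.  Converse of the tree's
`layeringGlue_proof : ZeroChargeBulk → ChargeFreeWindows`; hence, as filed, the unconditional
item is equivalent to the route's target. [folklore] -/
theorem zeroChargeBulk_of_chargeFreeWindows (hW : ChargeFreeWindows) : ZeroChargeBulk := by
  intro x hx
  have h := hW 1 one_pos x hx
  refine squeeze_zero (fun N => by positivity) (fun N => ?_) h
  refine div_le_div_of_nonneg_right ?_ (Nat.cast_nonneg N)
  have hcard : Nat.card {i : Fin N // ¬ IsChargeFree (1 / 100 : ℝ) (x N) i} ≤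
      Nat.card {i : Fin N // ¬ ∀ j : Fin N, dist (x N i) (x N j) ≤ 1 * nearestDist (x N) i →
        IsChargeFree (1 / 100 : ℝ) (x N) j} := by
    refine Nat.card_le_card_of_injective (fun i => ⟨i.1, fun h => i.2 (h i.1 ?_)⟩) ?_
    · rw [dist_self, one_mul]
      exact nearestDist_nonneg _ _
    · intro a b hab
      simp only [Subtype.mk.injEq] at hab
      exact Subtype.ext hab
  exact Nat.cast_le.2 hcard


/-! ### The equivalence with the target, pointwise / quantitative forms, and the reduction to the
priced gap (session 14236-1)

The results below make the status of the item machine-visible and reusable: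

* `chargeFreeWindows_iff_zeroChargeBulk : ChargeFreeWindows ↔ ZeroChargeBulk` — the item, as
  filed, IS the route's rank-0 target (it closes by `layeringGlue_proof h` from any proof
  `h : ZeroChargeBulk`, and refuting either refutes the other);
* `tendsto_charged_of_tendsto_badWindows` — hypothesis-free and pointwise: along ANY sequence of
  configurations, at any tolerance `η` and any radius `R ≥ 0`, if the bad-window fraction tends
  to `0` then so does the charged fraction (`j = i` lies in its own window);
* `card_badWindows_le_mul_card_charged` / `tendsto_badWindows_of_tendsto_charged` — the double
  count of `layeringGlue_proof` for ONE Lennard-Jones ground state (resp. one sequence of ground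
  states) at an arbitrary tolerance `η` and radius `R`: `#bad(R) ≤ (2R(10/δ)/δ + 1)³ · #charged`
  with `δ = min δ₀ 1`, `δ₀` the minimal distance of `LennardJonesMinimalDistance_holds`;
* `zeroChargeBulk_of_chargedEnergyGap` / `chargeFreeWindows_of_chargedEnergyGap` — the target,
  hence the item, follows from the rank-3 crux `ChargedEnergyGap` ALONE (pricing form
  `κ · #charged ≤ E_LJ(y) − N·e*` of the refuter lineage, `ChargedEnergyGapNegative.*`, and the
  unconditional energy limit `E(N)/N → e*`, `ChargedEnergyGapNegative.crysEnergyLimit`): the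
  item sits downstream of exactly one crux.
-/

/-- **The item is the target.** `ChargeFreeWindows ↔ ZeroChargeBulk`: the converse
`zeroChargeBulk_of_chargeFreeWindows` (window radius `1`, `j = i`) and the tree's glue
`layeringGlue_proof : LayeringGlue` (`= ZeroChargeBulk → ChargeFreeWindows`, double count with the
uniform bounds `δ ≤ nn_i ≤ 10/δ` on nearest-neighbour distances in Lennard-Jones ground states).
Consequently the support item `stmt-AtomisticToContinuum-14236` cannot be settled independently of
the target `stmt-AtomisticToContinuum-14229` (zero link charge a.e. in Lennard-Jones ground states
of `ℝ³`, crystallisation-strength). [folklore] -/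
theorem chargeFreeWindows_iff_zeroChargeBulk : ChargeFreeWindows ↔ ZeroChargeBulk :=
  ⟨zeroChargeBulk_of_chargeFreeWindows, layeringGlue_proof⟩

/-- **Pointwise, hypothesis-free direction.** For any sequence of configurations `x N` of `ℝ³`,
any tolerance `η` and any radius `R ≥ 0`: if the fraction of sites whose `R · nn_i`-window
contains a site that is not charge-free at `η` tends to `0`, then the fraction of sites that are
not charge-free at `η` tends to `0` — a charged site `i` spoils its own window
(`dist (x N i) (x N i) = 0 ≤ R · nn_i`). No ground-state hypothesis is used. [folklore] -/
theorem tendsto_charged_of_tendsto_badWindows (x : (N : ℕ) → (Fin N → EuclideanSpace ℝ (Fin 3)))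
    {η R : ℝ} (hR : 0 ≤ R)
    (h : Tendsto (fun N : ℕ => (Nat.card {i : Fin N // ¬ ∀ j : Fin N,
      dist (x N i) (x N j) ≤ R * nearestDist (x N) i → IsChargeFree η (x N) j} : ℝ) / N)
      atTop (𝓝 0)) :
    Tendsto (fun N : ℕ => (Nat.card {i : Fin N // ¬ IsChargeFree η (x N) i} : ℝ) / N)
      atTop (𝓝 0) := by
  refine squeeze_zero (fun N => by positivity) (fun N => ?_) h
  refine div_le_div_of_nonneg_right ?_ (Nat.cast_nonneg N)
  have hcard : Nat.card {i : Fin N // ¬ IsChargeFree η (x N) i} ≤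
      Nat.card {i : Fin N // ¬ ∀ j : Fin N, dist (x N i) (x N j) ≤ R * nearestDist (x N) i →
        IsChargeFree η (x N) j} := by
    refine Nat.card_le_card_of_injective (fun i => ⟨i.1, fun h => i.2 (h i.1 ?_)⟩) ?_
    · rw [dist_self]
      exact mul_nonneg hR (nearestDist_nonneg _ _)
    · intro a b hab
      simp only [Subtype.mk.injEq] at hab
      exact Subtype.ext hab
  exact Nat.cast_le.2 hcard

/-- **The double count for one ground state, at any tolerance.** In a Lennard-Jones ground state
`x` of `ℝ³` whose points are `δ`-separated (`0 < δ ≤ 1`), for every tolerance `η` and radius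
`R ≥ 0` the sites whose `R · nn_i`-window contains a site that is not charge-free at `η` number at
most `(2 R (10/δ)/δ + 1)³` times the sites that are not charge-free at `η`: each bad site lies in
the window set `{i : dist (x i) (x j) ≤ R · nn_i}` of a charged site `j`, which has at most that
many elements by `card_filter_window_le` (the `nn_i` are `≤ 10/δ` by
`nearestDist_le_of_isGroundState`). This is the counting step of `layeringGlue_proof`, isolated.
[folklore] -/
theorem card_badWindows_le_mul_card_charged {N : ℕ} {x : Fin N → EuclideanSpace ℝ (Fin 3)}
    (hx : IsGroundState lennardJones x) {δ : ℝ} (hδ : 0 < δ) (hδ1 : δ ≤ 1)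
    (hsep : ∀ k l, k ≠ l → δ ≤ dist (x k) (x l)) (η : ℝ) {R : ℝ} (hR : 0 ≤ R) :
    (Nat.card {i : Fin N // ¬ ∀ j : Fin N, dist (x i) (x j) ≤ R * nearestDist x i →
        IsChargeFree η x j} : ℝ) ≤
      (2 * (R * (10 / δ)) / δ + 1) ^ 3 * Nat.card {i : Fin N // ¬ IsChargeFree η x i} := by
  classical
  set K : ℝ := (2 * (R * (10 / δ)) / δ + 1) ^ 3 with hK_def
  set bad := Finset.univ.filter fun i : Fin N => ¬ ∀ j : Fin N,
    dist (x i) (x j) ≤ R * nearestDist x i → IsChargeFree η x j with hbad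
  set charged := Finset.univ.filter fun j : Fin N => ¬ IsChargeFree η x j with hcharged
  set W : Fin N → Finset (Fin N) := fun j =>
    Finset.univ.filter fun i => dist (x i) (x j) ≤ R * nearestDist x i with hW_def
  rw [Nat.subtype_card bad (fun i => by simp [hbad]),
    Nat.subtype_card charged (fun i => by simp [hcharged])]
  have hsub : bad ⊆ charged.biUnion W := by
    intro i hi
    obtain ⟨-, hi⟩ := Finset.mem_filter.1 hi
    push Not at hi
    obtain ⟨j, hij, hj⟩ := hi
    exact Finset.mem_biUnion.2 ⟨j, Finset.mem_filter.2 ⟨Finset.mem_univ _, hj⟩,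
      Finset.mem_filter.2 ⟨Finset.mem_univ _, hij⟩⟩
  have hW : ∀ j, ((W j).card : ℝ) ≤ K := fun j =>
    card_filter_window_le x hδ (by positivity) hR hsep
      (fun i => nearestDist_le_of_isGroundState hx hδ hδ1 hsep i) j
  calc (bad.card : ℝ) ≤ ((charged.biUnion W).card : ℝ) := by
        exact_mod_cast Finset.card_le_card hsub
    _ ≤ ∑ j ∈ charged, ((W j).card : ℝ) := by exact_mod_cast Finset.card_biUnion_le
    _ ≤ ∑ j ∈ charged, K := Finset.sum_le_sum fun j _ => hW j
    _ = K * charged.card := by rw [Finset.sum_const, nsmul_eq_mul, mul_comm]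

/-- **Pointwise converse along one sequence of ground states, at any tolerance and radius.** If
`x N` are Lennard-Jones ground states of `ℝ³` and the fraction of sites not charge-free at `η`
tends to `0`, then for every real `R` the fraction of sites whose `R · nn_i`-window contains a
site not charge-free at `η` tends to `0` (for `R < 0` the window is contained in the one of radius
`0`). With `η = 1/100` and the hypothesis for all sequences this is `layeringGlue_proof`.
[folklore] -/
theorem tendsto_badWindows_of_tendsto_charged {x : (N : ℕ) → (Fin N → EuclideanSpace ℝ (Fin 3))}
    (hx : ∀ N, IsGroundState lennardJones (x N)) {η : ℝ} (R : ℝ)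
    (h : Tendsto (fun N : ℕ => (Nat.card {i : Fin N // ¬ IsChargeFree η (x N) i} : ℝ) / N)
      atTop (𝓝 0)) :
    Tendsto (fun N : ℕ => (Nat.card {i : Fin N // ¬ ∀ j : Fin N,
      dist (x N i) (x N j) ≤ R * nearestDist (x N) i → IsChargeFree η (x N) j} : ℝ) / N)
      atTop (𝓝 0) := by
  classical
  obtain ⟨δ₀, hδ₀, hsep₀⟩ := LennardJonesMinimalDistance_holds
  set δ : ℝ := min δ₀ 1 with hδ_def
  have hδ : 0 < δ := lt_min hδ₀ one_pos
  have hδ1 : δ ≤ 1 := min_le_right _ _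
  have hsep : ∀ (N : ℕ) (k l : Fin N), k ≠ l → δ ≤ dist (x N k) (x N l) := fun N k l hkl =>
    (min_le_left _ _).trans (hsep₀ N (x N) (hx N) k l hkl)
  -- replace `R` by `R⁺ = max R 0 ≥ 0`: the bad set only grows
  set R' : ℝ := max R 0 with hR'_def
  have hR' : 0 ≤ R' := le_max_right _ _
  set K : ℝ := (2 * (R' * (10 / δ)) / δ + 1) ^ 3 with hK_def
  have hmono : ∀ N : ℕ,
      (Nat.card {i : Fin N // ¬ ∀ j : Fin N, dist (x N i) (x N j) ≤ R * nearestDist (x N) i →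
        IsChargeFree η (x N) j} : ℝ) ≤
        Nat.card {i : Fin N // ¬ ∀ j : Fin N, dist (x N i) (x N j) ≤ R' * nearestDist (x N) i →
          IsChargeFree η (x N) j} := by
    intro N
    refine Nat.cast_le.2 (Nat.card_le_card_of_injective
      (fun i => ⟨i.1, fun h' => i.2 fun j hj => h' j (hj.trans ?_)⟩) ?_)
    · exact mul_le_mul_of_nonneg_right (le_max_left _ _) (nearestDist_nonneg _ _)
    · intro a b hab
      simp only [Subtype.mk.injEq] at hab
      exact Subtype.ext hab
  have hlim := h.const_mul K
  rw [mul_zero] at hlim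
  refine squeeze_zero (fun N => by positivity) (fun N => ?_) hlim
  rw [← mul_div_assoc]
  refine div_le_div_of_nonneg_right ((hmono N).trans ?_) (Nat.cast_nonneg N)
  exact card_badWindows_le_mul_card_charged (hx N) hδ hδ1 (hsep N) η hR'

/-- **The target from the priced gap** (`ChargedEnergyGap → ZeroChargeBulk`; with the energy
limit this is the content of the support item `GapConsequences`, its second hypothesis
`CrysEnergyUpper` being proved in the tree). Along a sequence of Lennard-Jones ground states
`x N`, the pricing form of the crux (`ChargedEnergyGapNegative.chargedEnergyGap_iff_price`:
`κ · #charged(y) ≤ E_LJ(y) − N·e*` for every finite injective `y`, some `κ > 0`) gives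
`#charged(x N)/N ≤ (E(N)/N − e*)/κ` for `N ≥ 1`, and `E(N)/N → e*`
(`ChargedEnergyGapNegative.crysEnergyLimit`, unconditional); squeeze. [folklore] -/
theorem zeroChargeBulk_of_chargedEnergyGap (h : ChargedEnergyGap) : ZeroChargeBulk := by
  intro x hx
  obtain ⟨κ, hκ, hP⟩ := ChargedEnergyGapNegative.chargedEnergyGap_iff_price.1 h
  have hlim : Tendsto (fun N : ℕ => (groundStateEnergy lennardJones 3 N / N -
      ChargedEnergyGapNegative.eStar) / κ) atTop (𝓝 0) := by
    have h0 := (ChargedEnergyGapNegative.crysEnergyLimit.sub_const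
      ChargedEnergyGapNegative.eStar).div_const κ
    rwa [ChargedEnergyGapNegative.eStar, sub_self, zero_div] at h0
  refine tendsto_of_tendsto_of_tendsto_of_le_of_le' tendsto_const_nhds hlim
    (Eventually.of_forall fun N => by positivity) ?_
  filter_upwards [eventually_ge_atTop 1] with N hN
  have hNr : (0 : ℝ) < N := by exact_mod_cast hN
  have hb := hP N (x N) (hx N).1
  rw [(hx N).2] at hb
  have hE : (groundStateEnergy lennardJones 3 N / N - ChargedEnergyGapNegative.eStar) * N =
      groundStateEnergy lennardJones 3 N - N * ChargedEnergyGapNegative.eStar := by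
    rw [sub_mul, div_mul_cancel₀ _ hNr.ne', mul_comm]
  rw [le_div_iff₀ hκ, div_mul_eq_mul_div, div_le_iff₀ hNr, hE, mul_comm]
  exact hb

/-- **The item from the priced gap** (`ChargedEnergyGap → ChargeFreeWindows`): compose
`zeroChargeBulk_of_chargedEnergyGap` with the glue `layeringGlue_proof`. So, as filed, the
support item `stmt-AtomisticToContinuum-14236` is downstream of the single crux
`stmt-AtomisticToContinuum-14231` (and equivalent to the target `stmt-AtomisticToContinuum-14229`).
[folklore] -/
theorem chargeFreeWindows_of_chargedEnergyGap (h : ChargedEnergyGap) : ChargeFreeWindows :=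
  layeringGlue_proof (zeroChargeBulk_of_chargedEnergyGap h)

end Summit.AtomisticToContinuum.Crystallization.Theorems
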